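import Literature.RingTheory.CohomologyAnnihilator.TowerRestrict
import Literature.RingTheory.CohomologyAnnihilator.StableAnnihilation
import Mathlib.RingTheory.Flat.TorsionFree
import Mathlib.LinearAlgebra.Isomorphisms
import HarnessLib

/-!
# Syzygies modulo a regular element (Dao–Takahashi Lemma 5.6, Iyengar–Takahashi Remark 2.12)

Topic: `Literature/RingTheory/CohomologyAnnihilator`. The two facts about reduction modulo an
element `a ∈ R` used in the domain case of the proof of [IyengarTakahashi2014, Theorem 5.1]
("`N/aN ≅ Ω^{s+d-2}_{R/aR}(Ω_R M / a Ω_R M)` … `a` is a non-zerodivisor on `N`. Therefore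
Remark 2.12 yields that `N` is a direct summand of `Ω_R(N/aN)`"):

* `IsSyzygy.quotSMulTop` — **[DaoTakahashi2014, Lemma 5.6]**: if `a ∈ R` is a non-zero-divisor
  of `R` and of `X`, and `Y = Ωᵐ_R X` (any chain of syzygy sequences with finitely generated
  projective middles), then `Y/aY` is an `m`-th syzygy of `X/aX` over `R/aR` (the sequences stay
  exact modulo `a`, the middles stay finitely generated projective), and `a` is a
  non-zero-divisor on `Y`;
* `exists_retract_isSyzygy_quotSMulTop` — **[IyengarTakahashi2014, Remark 2.12]** in the form
  used: if `a` is `N`-regular and kills `Ext¹_R(N, mod R)`, then `N` is a retract (direct summand)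
  of a first syzygy `Ω_R(N/aN)` (the pull-back of a finite free cover `F ↠ N` along `a : N → N`
  splits, and is isomorphic to `Ker(F → N/aN)`).

`R/aR`-modules are `ModuleCat (R ⧸ Ideal.span {a})`-objects on the quotients `X ⧸ a • ⊤`
(Mathlib's instance `Module (R ⧸ Ideal.span {a}) (X ⧸ a • ⊤)`).

## References

* S. B. Iyengar, R. Takahashi, *Annihilation of cohomology and strong generation of module
  categories*, IMRN 2016; arXiv:1404.1476 — Remark 2.12, proof of Theorem 5.1.
  [`IyengarTakahashi2014`]
* H. Dao, R. Takahashi, *The radius of a subcategory of modules*, Algebra Number Theory 8 (2014),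
  Lemma 5.6. [`DaoTakahashi2014`]
-/

noncomputable section

open CategoryTheory CategoryTheory.Limits
open scoped Pointwise nonZeroDivisors

universe u

namespace Literature.RingTheory.CohomologyAnnihilator

variable {R : Type u} [CommRing R]

/-! ## Generalities on `X ⧸ aX` as an `R/aR`-module -/

/-- `R → R/aR → End(X/aX)` is a scalar tower. [folklore] -/
theorem isScalarTower_quotSMulTop (a : R) (X : Type u) [AddCommGroup X] [Module R X] :
    IsScalarTower R (R ⧸ Ideal.span {a}) (X ⧸ (a • ⊤ : Submodule R X)) :=
  IsScalarTower.of_algebraMap_smul fun _ _ => rfl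

attribute [local instance] isScalarTower_quotSMulTop

/-- `R → R/aR` is onto. [folklore] -/
theorem algebraMap_quotient_surjective (I : Ideal R) :
    Function.Surjective (algebraMap R (R ⧸ I)) :=
  Ideal.Quotient.mk_surjective

/-- An `R`-linear map `f : Y → X` induces an `R/aR`-linear map `Y/aY → X/aX`, `ȳ ↦ f(y)̄`.
[folklore] -/
theorem exists_hom_quotSMulTop (a : R) {Y X : Type u} [AddCommGroup Y] [Module R Y]
    [AddCommGroup X] [Module R X] (f : Y →ₗ[R] X) :
    ∃ fq : ModuleCat.of (R ⧸ Ideal.span {a}) (Y ⧸ (a • ⊤ : Submodule R Y)) ⟶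
        ModuleCat.of (R ⧸ Ideal.span {a}) (X ⧸ (a • ⊤ : Submodule R X)),
      ∀ y : Y, fq (Submodule.Quotient.mk y) = Submodule.Quotient.mk (f y) := by
  have h : (a • ⊤ : Submodule R Y) ≤ (a • ⊤ : Submodule R X).comap f := by
    intro y hy
    obtain ⟨y', -, rfl⟩ := (Submodule.mem_smul_pointwise_iff_exists _ _ _).1 hy
    rw [Submodule.mem_comap, map_smul]
    exact Submodule.smul_mem_pointwise_smul _ _ _ trivial
  exact ⟨ModuleCat.ofHom (LinearMap.extendScalarsOfSurjective (algebraMap_quotient_surjective _)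
    ((a • ⊤ : Submodule R Y).mapQ (a • ⊤ : Submodule R X) f h)), fun y => rfl⟩

/-- A submodule of an `a`-torsion-free module is `a`-torsion-free. [folklore] -/
theorem isSMulRegular_of_injective {a : R} {Y X : Type*} [AddCommGroup Y] [Module R Y]
    [AddCommGroup X] [Module R X] (f : Y →ₗ[R] X) (hf : Function.Injective f)
    (h : IsSMulRegular X a) : IsSMulRegular Y a := fun y₁ y₂ hy =>
  hf (h (by simpa using congrArg f hy))

/-- Projective modules are torsion-free with respect to non-zero-divisors. [folklore] -/
theorem isSMulRegular_of_projective {a : R} (ha : a ∈ R⁰) (P : ModuleCat.{u} R)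
    (hP : Projective P) : IsSMulRegular P a := by
  haveI := moduleProjective_of_projective P hP
  exact Module.Flat.isSMulRegular_of_nonZeroDivisors ha

/-- `Rⁿ/aRⁿ ≅ (R/aR)ⁿ` is a free, hence projective, `R/aR`-module. [folklore] -/
theorem moduleProjective_pi_quotSMulTop (a : R) (n : ℕ) :
    Module.Projective (R ⧸ Ideal.span {a}) ((Fin n → R) ⧸ (a • ⊤ : Submodule R (Fin n → R))) := by
  let φ : (Fin n → R) →ₗ[R] (Fin n → R ⧸ Ideal.span {a}) :=
    (Algebra.linearMap R (R ⧸ Ideal.span {a})).compLeft (Fin n)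
  have hφ : ∀ v i, φ v i = Ideal.Quotient.mk (Ideal.span {a}) (v i) := fun v i => rfl
  have hφsurj : Function.Surjective φ := fun v =>
    ⟨fun i => (Ideal.Quotient.mk_surjective (v i)).choose,
      funext fun i => by rw [hφ]; exact (Ideal.Quotient.mk_surjective (v i)).choose_spec⟩
  have hker : LinearMap.ker φ = (a • ⊤ : Submodule R (Fin n → R)) := by
    ext v
    rw [LinearMap.mem_ker, Submodule.mem_smul_pointwise_iff_exists]
    constructor
    · intro hv
      have hv' : ∀ i, v i ∈ Ideal.span {a} := fun i =>
        Ideal.Quotient.eq_zero_iff_mem.1 (by rw [← hφ]; exact congrFun hv i)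
      choose c hc using fun i => Ideal.mem_span_singleton'.1 (hv' i)
      exact ⟨c, Submodule.mem_top, funext fun i => by
        rw [Pi.smul_apply, smul_eq_mul, mul_comm]; exact hc i⟩
    · rintro ⟨c, -, rfl⟩
      funext i
      rw [hφ, Pi.zero_apply, Ideal.Quotient.eq_zero_iff_mem, Pi.smul_apply, smul_eq_mul]
      exact Ideal.mul_mem_right _ _ (Ideal.mem_span_singleton_self a)
  let e : ((Fin n → R) ⧸ (a • ⊤ : Submodule R (Fin n → R))) ≃ₗ[R] (Fin n → R ⧸ Ideal.span {a}) :=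
    Submodule.quotEquivOfEq _ _ hker.symm ≪≫ₗ LinearMap.quotKerEquivOfSurjective φ hφsurj
  exact Module.Projective.of_equiv
    (e.extendScalarsOfSurjective (algebraMap_quotient_surjective _)).symm

/-- For `P` finitely generated projective over `R`, `P/aP` is (finitely generated) projective over
`R/aR` (a direct summand of `Rⁿ/aRⁿ`). [cite: DaoTakahashi2014, Lemma 5.6 (proof)] -/
theorem projective_quotSMulTop (a : R) (P : ModuleCat.{u} R) [Module.Finite R P]
    (hP : Projective P) :
    Projective (ModuleCat.of (R ⧸ Ideal.span {a}) (P ⧸ (a • ⊤ : Submodule R P))) := by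
  haveI := moduleProjective_of_projective P hP
  obtain ⟨n, π, hπ⟩ := Module.Finite.exists_fin' R P
  obtain ⟨s, hs⟩ := Module.projective_lifting_property π LinearMap.id hπ
  haveI := moduleProjective_pi_quotSMulTop a n
  obtain ⟨sq, hsq⟩ := exists_hom_quotSMulTop a s
  obtain ⟨πq, hπq⟩ := exists_hom_quotSMulTop a π
  have hsplit : πq.hom.comp sq.hom = LinearMap.id := by
    refine LinearMap.ext fun z => ?_
    induction z using Submodule.Quotient.induction_on with
    | _ p =>
      change πq (sq (Submodule.Quotient.mk p)) = Submodule.Quotient.mk p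
      rw [hsq, hπq, ← LinearMap.comp_apply, hs, LinearMap.id_apply]
  haveI := Module.Projective.of_split sq.hom πq.hom hsplit
  exact (IsProjective.iff_projective (R := R ⧸ Ideal.span {a}) (P ⧸ (a • ⊤ : Submodule R P))).mp
    inferInstance

/-! ## Dao–Takahashi, Lemma 5.6: syzygies reduce modulo a regular element -/

/-- **[DaoTakahashi2014, Lemma 5.6]** (as used in [IyengarTakahashi2014, Thm. 5.1]): let `a` be
a non-zero-divisor of `R` which is regular on `X`, and `Y = Ωᵐ_R X` an `m`-th syzygy (any chain of
syzygy sequences with finitely generated projective middles). Then `Y/aY` is an `m`-th syzygy of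
`X/aX` over `R/aR`, and `a` is regular on `Y`. Induction on `m`: for `0 → Y → P → Y' → 0` with
`a` regular on `Y'`, the sequence `0 → Y/aY → P/aP → Y'/aY' → 0` is exact and `P/aP` is finitely
generated projective over `R/aR`. [cite: DaoTakahashi2014, Lemma 5.6; IyengarTakahashi2014,
Thm. 5.1 (proof)] -/
theorem IsSyzygy.quotSMulTop {a : R} (ha : a ∈ R⁰) {m : ℕ} :
    ∀ {X Y : ModuleCat.{u} R}, IsSyzygy m X Y → IsSMulRegular X a →
      IsSyzygy m (ModuleCat.of (R ⧸ Ideal.span {a}) (X ⧸ (a • ⊤ : Submodule R X)))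
        (ModuleCat.of (R ⧸ Ideal.span {a}) (Y ⧸ (a • ⊤ : Submodule R Y))) ∧ IsSMulRegular Y a := by
  induction m with
  | zero =>
    intro X Y hXY hX
    obtain ⟨e⟩ := hXY
    refine ⟨⟨LinearEquiv.toModuleIso ((Submodule.Quotient.equiv (a • ⊤) (a • ⊤)
      e.toLinearEquiv ?_).extendScalarsOfSurjective (algebraMap_quotient_surjective _))⟩,
      isSMulRegular_of_injective e.toLinearEquiv.toLinearMap e.toLinearEquiv.injective hX⟩
    rw [Submodule.map_pointwise_smul, Submodule.map_top, LinearEquiv.range]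
  | succ m ih =>
    intro X Y hXY hX
    obtain ⟨Y', P, hY', hP, hproj, f, g, w, hS⟩ := hXY
    obtain ⟨hq', hreg'⟩ := ih hY' hX
    obtain ⟨hf, hg, hfg⟩ := shortExact_unpack hS
    have hregP : IsSMulRegular P a := isSMulRegular_of_projective ha P hproj
    have hregY : IsSMulRegular Y a := isSMulRegular_of_injective f.hom hf hregP
    obtain ⟨fq, hfq⟩ := exists_hom_quotSMulTop a f.hom
    obtain ⟨gq, hgq⟩ := exists_hom_quotSMulTop a g.hom
    have hgf : ∀ y, g.hom (f.hom y) = 0 := hfg.apply_apply_eq_zero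
    have hfq_inj : Function.Injective fq := by
      intro z₁ z₂ h
      induction z₁ using Submodule.Quotient.induction_on with
      | _ y₁ =>
        induction z₂ using Submodule.Quotient.induction_on with
        | _ y₂ =>
          rw [hfq, hfq, Submodule.Quotient.eq] at h
          obtain ⟨p, -, hp⟩ := (Submodule.mem_smul_pointwise_iff_exists _ _ _).1 h
          have hgp : g.hom p = 0 := by
            refine hreg' ?_
            dsimp only
            rw [← map_smul, hp, map_sub, hgf, hgf, sub_self, smul_zero]
          obtain ⟨y₀, hy₀⟩ := (hfg _).1 hgp
          rw [Submodule.Quotient.eq]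
          refine (Submodule.mem_smul_pointwise_iff_exists _ _ _).2 ⟨y₀, trivial, hf ?_⟩
          have hy₀' : f.hom y₀ = p := hy₀
          rw [map_smul, map_sub, hy₀', hp]
    have hgq_surj : Function.Surjective gq := by
      intro z
      induction z using Submodule.Quotient.induction_on with
      | _ y' =>
        obtain ⟨p, rfl⟩ := hg y'
        exact ⟨Submodule.Quotient.mk p, hgq p⟩
    have hexact : Function.Exact fq gq := by
      intro z
      induction z using Submodule.Quotient.induction_on with
      | _ p =>
        rw [hgq, Submodule.Quotient.mk_eq_zero]
        constructor
        · intro h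
          obtain ⟨y', -, hy'⟩ := (Submodule.mem_smul_pointwise_iff_exists _ _ _).1 h
          obtain ⟨p', hp'⟩ := hg y'
          have hp'' : g.hom p' = y' := hp'
          have h0 : g.hom (p - a • p') = 0 := by
            rw [map_sub, map_smul, hp'']
            exact sub_eq_zero.mpr hy'.symm
          obtain ⟨y, hy⟩ := (hfg _).1 h0
          have hy'' : f.hom y = p - a • p' := hy
          refine ⟨Submodule.Quotient.mk y, ?_⟩
          rw [hfq, Submodule.Quotient.eq]
          refine (Submodule.mem_smul_pointwise_iff_exists _ _ _).2 ⟨-p', trivial, ?_⟩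
          rw [hy'', smul_neg, sub_sub_cancel_left]
        · rintro ⟨z, hz⟩
          induction z using Submodule.Quotient.induction_on with
          | _ y =>
            rw [hfq, Submodule.Quotient.eq] at hz
            obtain ⟨q, -, hq⟩ := (Submodule.mem_smul_pointwise_iff_exists _ _ _).1 hz
            refine (Submodule.mem_smul_pointwise_iff_exists _ _ _).2 ⟨g.hom (-q), trivial, ?_⟩
            have hp : p = f.hom y - a • q := by rw [hq, sub_sub_cancel]
            rw [hp, map_sub, map_smul, map_neg, smul_neg, hgf, zero_sub]
    have w' : fq ≫ gq = 0 :=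
      ModuleCat.hom_ext (LinearMap.ext fun z => hexact.apply_apply_eq_zero z)
    have hS' : (ShortComplex.mk fq gq w').ShortExact :=
      ModuleCat.shortComplex_shortExact _ hexact hfq_inj hgq_surj
    haveI := hP
    have hPfin : Module.Finite (R ⧸ Ideal.span {a}) (P ⧸ (a • ⊤ : Submodule R P)) :=
      Module.Finite.of_restrictScalars_finite R _ _
    exact ⟨⟨_, _, hq', hPfin, projective_quotSMulTop a P hproj, fq, gq, w', hS'⟩, hregY⟩

/-! ## Iyengar–Takahashi, Remark 2.12: `N` is a direct summand of `Ω_R(N/aN)` -/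

/-- **[IyengarTakahashi2014, Remark 2.12]** in the form used in the proof of Theorem 5.1: let
`N` be a finitely generated module over a noetherian ring, `a ∈ R` regular on `N` and killing
`Ext¹_R(N, Y)` for all finitely generated `Y`. Then `N` is a retract of a first syzygy module of
`N/aN`. Proof: for a finite free cover `π : F ↠ N` the class of `0 → K → F → N → 0` is killed by
`a`, so `a · 𝟙_N` lifts to `ψ : N → F` (`π ψ = a`); then `L = π⁻¹(aN) = Ker(F → N/aN)` is a first
syzygy of `N/aN`, `ψ` lands in `L`, and `L → N`, `l ↦ a⁻¹ π(l)` (well defined as `a` is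
`N`-regular) retracts it. [cite: IyengarTakahashi2014, Remark 2.12] -/
theorem exists_retract_isSyzygy_quotSMulTop [IsNoetherianRing R] {a : R} {N : ModuleCat.{u} R}
    [Module.Finite R N] (hreg : IsSMulRegular N a)
    (hN : ∀ Y : ModuleCat.{u} R, Module.Finite R Y → ∀ e : Abelian.Ext.{u} N Y 1, a • e = 0) :
    ∃ L : ModuleCat.{u} R, IsSyzygy 1 (ModuleCat.of R (N ⧸ (a • ⊤ : Submodule R N))) L ∧
      ∃ (i : N ⟶ L) (p : L ⟶ N), i ≫ p = 𝟙 N := by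
  -- a finite free cover and the lift of `a · 𝟙`
  obtain ⟨n, π, hπ⟩ := Module.Finite.exists_fin' R N
  let F := ModuleCat.of R (Fin n → R)
  have hT := LinearMap.shortExact_shortComplexKer hπ
  haveI : Module.Finite R (LinearMap.ker π) := Module.IsNoetherian.finite R _
  have hclass : a • hT.extClass = 0 := hN (ModuleCat.of R (LinearMap.ker π)) inferInstance _
  obtain ⟨ψ, hψ⟩ := exists_comp_eq_smul_id_X₃_of_smul_extClass_eq_zero hT hclass
  have hψ' : ∀ x : N, π (ψ.hom x) = a • x := fun x => by
    have := congrArg (fun φ => φ.hom x) hψ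
    simpa using this
  -- `L = Ker(F → N/aN)`
  let ρ : (Fin n → R) →ₗ[R] N ⧸ (a • ⊤ : Submodule R N) := (a • ⊤ : Submodule R N).mkQ ∘ₗ π
  have hρ : Function.Surjective ρ := (Submodule.mkQ_surjective _).comp hπ
  let L := LinearMap.ker ρ
  obtain ⟨wL, hSL⟩ := exists_shortExact_of_linearMap (Y := ModuleCat.of R L) (M := F)
    (X := ModuleCat.of R (N ⧸ (a • ⊤ : Submodule R N))) L.subtype ρ Subtype.val_injective hρ
    (LinearMap.exact_subtype_ker_map ρ)
  have hL : IsSyzygy 1 (ModuleCat.of R (N ⧸ (a • ⊤ : Submodule R N))) (ModuleCat.of R L) :=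
    isSyzygy_one_iff.mpr ⟨F, inferInstance,
      (IsProjective.iff_projective (R := R) (Fin n → R)).mp inferInstance, _, _, wL, hSL⟩
  -- `i : N → L`, `x ↦ ψ x`
  have hmemL : ∀ x : N, ψ.hom x ∈ L := fun x => by
    change (a • ⊤ : Submodule R N).mkQ (π (ψ.hom x)) = 0
    rw [hψ', Submodule.mkQ_apply, Submodule.Quotient.mk_eq_zero]
    exact Submodule.smul_mem_pointwise_smul _ _ _ trivial
  let i : N →ₗ[R] L := LinearMap.codRestrict L ψ.hom hmemL
  -- `p : L → N`, `l ↦ a⁻¹ π l`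
  let ma : N →ₗ[R] N := LinearMap.lsmul R N a
  have hma : Function.Injective ma := hreg
  have hrange : ∀ l : L, π l.1 ∈ LinearMap.range ma := fun l => by
    have hl : ρ l.1 = 0 := l.2
    change (a • ⊤ : Submodule R N).mkQ (π l.1) = 0 at hl
    rw [Submodule.mkQ_apply, Submodule.Quotient.mk_eq_zero] at hl
    obtain ⟨y, -, hy⟩ := (Submodule.mem_smul_pointwise_iff_exists _ _ _).1 hl
    exact ⟨y, hy⟩
  let p : L →ₗ[R] N := (LinearEquiv.ofInjective ma hma).symm.toLinearMap ∘ₗ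
    LinearMap.codRestrict (LinearMap.range ma) (π ∘ₗ L.subtype) hrange
  have hp : ∀ l : L, a • p l = π l.1 := fun l => by
    have h := congrArg Subtype.val ((LinearEquiv.ofInjective ma hma).apply_symm_apply
      ⟨π l.1, hrange l⟩)
    rw [LinearEquiv.ofInjective_apply] at h
    exact h
  refine ⟨ModuleCat.of R L, hL, ModuleCat.ofHom i, ModuleCat.ofHom p, ?_⟩
  apply ModuleCat.hom_ext
  refine LinearMap.ext fun x => hreg ?_
  change a • p (i x) = a • x
  rw [hp]
  exact hψ' x

end Literature.RingTheory.CohomologyAnnihilator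

end
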